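import Summits.QuantumFields.QCD.Theorems.QuarksAsStableActionStableActionBridgeStubEigenRayleigh
import HarnessLib

/-!
# Stub `stub_eigenvector_to_eigenwave` of line `twisted_trace_transfer`
# for crux `QuarksAsStableAction.StableActionBridge` (item stmt-QuantumFields-9737)

The registered stub `stub_eigenvector_to_eigenwave` of step E3: **an eigenvector with non-zero eigenvalue
of the scalarised QCD transfer operator is `R Ψ` for a continuous gauge-invariant EIGENWAVE `Ψ` of the
`R`-free transfer map.**  E3 realises Lüscher's transfer matrix (Lüscher, CMP 54 (1977); Smit, *Introduction
to Quantum Fields on a Lattice*, §6.5 (6.87)) as the `L²(ρ)`, `ρ = Haar ⊗ count`, integral operator `A` on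
`Y = SU(3)^{E₃} × Finset(modes)` with kernel `k((U,s),(U',s')) = (R(U) B(U,U') R(U'))_{s s'}`, where `R` is a
continuous pointwise Hermitian square root of `T̂_F = fermionSliceOp` and
`B(U,U') = ∫ K_β(U,U'^g) Γ(G_g) dg` is the Gauss-averaged Wilson gauge kernel.  The vacuum-parity argument
of the line works with eigenwaves of the `R`-free transfer map `(𝒯Ψ)(U) = ∫ B(U,U') T̂_F(U') Ψ(U') dU'` on
continuous gauge-invariant waves (charge conjugation acts naturally there); this stub turns an eigenvector
`A φ = λ φ`, `λ ≠ 0`, into such an eigenwave: there is a continuous gauge-invariant `Ψ` with `R Ψ = φ`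
`ρ`-a.e. and `𝒯Ψ = λ Ψ` exactly.

Proof.  As in the landed sibling `stub_eigen_rayleigh` (whose helpers in the sub-namespace
`StubEigenRayleigh` are reused, not re-proved): `Ψ(U)_a := λ⁻¹ ∫ (B(U,U') R(U'))_{a s'} φ(U',s') dρ` is
continuous by dominated convergence (`StubEigenRayleigh.continuous_wave`), gauge invariant by the left
covariance `B(U^h,U') = Γ(G_h) B(U,U')` of the bond kernel (`StubEigenRayleigh.bondKernel_gaugeTransform_left`,
`StubEigenRayleigh.wave_covariance`), and `(R(U)Ψ(U))_s = λ⁻¹ ∫ k((U,s),·) φ dρ` (finite sums through the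
integral, `StubEigenRayleigh.mulVec_wave`), so `R Ψ = λ⁻¹ A φ = φ` a.e. by the kernel formula and
`A φ = λ φ`.  The eigenwave equation, for EVERY `U` and `a`:
`∫ ((B(U,U') T̂_F(U')) Ψ(U'))_a dU' = ∫ Σ_{s'} (B(U,U') R(U'))_{a s'} (R(U')Ψ(U'))_{s'} dU'` (`T̂_F = R R`)
`= ∫ (B(U,y'₁) R(y'₁))_{a y'₂} (RΨ)(y') dρ(y')` (unscalarisation `∫ dρ = ∫ dU Σ_s` of a function with
continuous sections, `StubRayleighLeOfEigenLe.integral_prod_count`) `= ∫ (B R)_{a ·} φ dρ` (`RΨ = φ` a.e.;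
integrals ignore null sets) `= λ Ψ(U)_a` (definition of `Ψ`).  The hypothesis `φ ≠ 0` of the sibling is not
needed (for `φ = 0` the construction gives `Ψ = 0`).  The analysis is done for an abstract bond kernel with
jointly continuous entries and left covariance (`StubEigenvectorToEigenwave.main_of_bondKernel`) and
specialised at the end (`stub_bondKernel_continuous`).  Pure theorem file (no definitions, no notation);
helpers in the sub-namespace `StubEigenvectorToEigenwave`.

[cite: Luscher1977, pp. 283–292] [cite: Smit2023, §4.6 (4.127)–(4.137) and §6.5 (6.87)]
[cite: ReedSimonIV1978, Thm XIII.1]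
-/

noncomputable section

namespace Summit.QuantumFields.QCD.Cruxes.StableActionBridge.TwistedTraceTransfer

open MeasureTheory Filter
open scoped InnerProductSpace ComplexConjugate Matrix BigOperators
open Literature.MathematicalPhysics.QuantumFieldTheory Literature.MathematicalPhysics.QuantumLattice
open Literature.Probability.LatticeModels (TorusSite)

namespace StubEigenvectorToEigenwave

open StubEigenRayleigh

variable {Nf S : ℕ} [NeZero S]

/-- **Eigenvectors with non-zero eigenvalue come from eigenwaves** — the stub for an abstract bond kernel
`B` on the QCD slice with jointly continuous entries and left covariance `B(U^h,U') = Γ(G_h) B(U,U')`, and a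
continuous pointwise square root `R` of `T̂_F` (`R(U) R(U) = T̂_F(U)`).  If `A` is given a.e. by
`k((U,s),(U',s')) = (R(U) B(U,U') R(U'))_{s s'}` on `L²(Haar ⊗ count)` and `A φ = λ φ`, `λ ≠ 0`, then the wave
function `Ψ(U)_a = λ⁻¹ ∫ (B(U,U') R(U'))_{a s'} φ(U',s') dρ` of `φ` is continuous, gauge invariant,
`R Ψ = φ` a.e., and `∫ B(U,U') T̂_F(U') Ψ(U') dU' = λ Ψ(U)` for every `U`.
[cite: Luscher1977, pp. 283–292] [cite: ReedSimonIV1978, Thm XIII.1] -/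
theorem main_of_bondKernel
    {R : GaugeConfig 3 S (Matrix.specialUnitaryGroup (Fin 3) ℂ) →
      Matrix (Finset (SliceFermiIdx Nf S)) (Finset (SliceFermiIdx Nf S)) ℂ} (hRc : Continuous R)
    {B : GaugeConfig 3 S (Matrix.specialUnitaryGroup (Fin 3) ℂ) →
      GaugeConfig 3 S (Matrix.specialUnitaryGroup (Fin 3) ℂ) →
      Matrix (Finset (SliceFermiIdx Nf S)) (Finset (SliceFermiIdx Nf S)) ℂ}
    (hBc : ∀ a c, Continuous fun p : GaugeConfig 3 S (Matrix.specialUnitaryGroup (Fin 3) ℂ) ×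
      GaugeConfig 3 S (Matrix.specialUnitaryGroup (Fin 3) ℂ) => B p.1 p.2 a c) (mq : Fin Nf → ℝ)
    (hBcov : ∀ h U U', B (gaugeTransform h U) U' = fockGaugeAct h * B U U')
    (hRsq : ∀ U, R U * R U = fermionSliceOp U mq)
    (k : GaugeConfig 3 S (Matrix.specialUnitaryGroup (Fin 3) ℂ) × Finset (SliceFermiIdx Nf S) →
      GaugeConfig 3 S (Matrix.specialUnitaryGroup (Fin 3) ℂ) × Finset (SliceFermiIdx Nf S) → ℂ)
    (hk : ∀ y y', k y y' = (R y.1 * B y.1 y'.1 * R y'.1) y.2 y'.2)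
    (A : Lp ℂ 2 ((sliceHaar S).prod (Measure.count : Measure (Finset (SliceFermiIdx Nf S)))) →L[ℂ]
        Lp ℂ 2 ((sliceHaar S).prod (Measure.count : Measure (Finset (SliceFermiIdx Nf S)))))
    (hA : ∀ φ : Lp ℂ 2 ((sliceHaar S).prod (Measure.count : Measure (Finset (SliceFermiIdx Nf S)))),
        (A φ : GaugeConfig 3 S (Matrix.specialUnitaryGroup (Fin 3) ℂ) × Finset (SliceFermiIdx Nf S) → ℂ)
          =ᵐ[(sliceHaar S).prod (Measure.count : Measure (Finset (SliceFermiIdx Nf S)))]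
          fun y => ∫ y', k y y' * φ y' ∂((sliceHaar S).prod (Measure.count : Measure (Finset (SliceFermiIdx Nf S)))))
    (φ : Lp ℂ 2 ((sliceHaar S).prod (Measure.count : Measure (Finset (SliceFermiIdx Nf S))))) (lam : ℝ)
    (hlam : lam ≠ 0) (hAφ : A φ = (lam : ℂ) • φ) :
    ∃ Ψ : SliceWave Nf S, Continuous Ψ ∧ IsGaugeInvariantWave Ψ ∧
      ((fun y : GaugeConfig 3 S (Matrix.specialUnitaryGroup (Fin 3) ℂ) × Finset (SliceFermiIdx Nf S) =>
          (R y.1 *ᵥ Ψ y.1) y.2)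
        =ᵐ[(sliceHaar S).prod (Measure.count : Measure (Finset (SliceFermiIdx Nf S)))]
        (φ : GaugeConfig 3 S (Matrix.specialUnitaryGroup (Fin 3) ℂ) × Finset (SliceFermiIdx Nf S) → ℂ)) ∧
      ∀ (U : GaugeConfig 3 S (Matrix.specialUnitaryGroup (Fin 3) ℂ)) (a : Finset (SliceFermiIdx Nf S)),
        (∫ U', ((B U U' * fermionSliceOp U' mq) *ᵥ Ψ U') a ∂(sliceHaar S)) = (lam : ℂ) * Ψ U a := by
  haveI := Sketch.isProbabilityMeasure_sliceHaar S
  have hlamC : (lam : ℂ) ≠ 0 := Complex.ofReal_ne_zero.mpr hlam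
  -- the wave function `Ψ` of `φ`
  obtain ⟨Ψ, hΨ⟩ : ∃ Ψ : SliceWave Nf S, ∀ U a, Ψ U a = (lam : ℂ)⁻¹ *
      ∫ y', (B U y'.1 * R y'.1) a y'.2 * φ y' ∂((sliceHaar S).prod Measure.count) := ⟨_, fun _ _ => rfl⟩
  have hΨc : Continuous Ψ := continuous_wave hRc hBc φ hΨ
  have hΨg : IsGaugeInvariantWave Ψ := fun h U => wave_covariance hRc hBc φ hΨ (hBcov h U)
  -- `R Ψ = λ⁻¹ A_k φ` pointwise, hence `R Ψ = φ` almost everywhere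
  have hbI : ∀ y : GaugeConfig 3 S (Matrix.specialUnitaryGroup (Fin 3) ℂ) × Finset (SliceFermiIdx Nf S),
      (R y.1 *ᵥ Ψ y.1) y.2 = (lam : ℂ)⁻¹ * ∫ y', k y y' * φ y' ∂((sliceHaar S).prod Measure.count) := by
    rintro ⟨U, s⟩
    simp only [hk]
    exact mulVec_wave hRc hBc φ hΨ U s
  have hae : (fun y : GaugeConfig 3 S (Matrix.specialUnitaryGroup (Fin 3) ℂ) × Finset (SliceFermiIdx Nf S) =>
        (R y.1 *ᵥ Ψ y.1) y.2)
      =ᵐ[(sliceHaar S).prod (Measure.count : Measure (Finset (SliceFermiIdx Nf S)))] (φ : _ → ℂ) := by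
    have h1 := hA φ
    rw [hAφ] at h1
    filter_upwards [h1, Lp.coeFn_smul (lam : ℂ) φ] with y hy hy'
    rw [hbI, ← hy, hy', Pi.smul_apply, smul_eq_mul, ← mul_assoc, inv_mul_cancel₀ hlamC, one_mul]
  refine ⟨Ψ, hΨc, hΨg, hae, fun U a => ?_⟩
  -- the eigenwave equation at `U`, component `a`
  have hBRc : ∀ s' : Finset (SliceFermiIdx Nf S), Continuous fun U' => (B U U' * R U') a s' := fun s' =>
    ((continuous_BR hRc hBc).matrix_elem a s').comp'
      (Continuous.prodMk_right (Y := GaugeConfig 3 S (Matrix.specialUnitaryGroup (Fin 3) ℂ)) U)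
  have hbU : ∀ s' : Finset (SliceFermiIdx Nf S), Continuous fun U' => (R U' *ᵥ Ψ U') s' := fun s' =>
    (continuous_apply s').comp' (hRc.matrix_mulVec hΨc)
  calc ∫ U', ((B U U' * fermionSliceOp U' mq) *ᵥ Ψ U') a ∂(sliceHaar S)
      = ∫ U', ∑ s', (B U U' * R U') a s' * (R U' *ᵥ Ψ U') s' ∂(sliceHaar S) := by
        refine integral_congr_ae (Eventually.of_forall fun U' => ?_)
        dsimp only
        rw [← hRsq U', ← Matrix.mul_assoc, ← Matrix.mulVec_mulVec]
        rfl
    _ = ∫ y', (B U y'.1 * R y'.1) a y'.2 * (R y'.1 *ᵥ Ψ y'.1) y'.2 ∂((sliceHaar S).prod Measure.count) :=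
        (StubRayleighLeOfEigenLe.integral_prod_count
          (f := fun y' => (B U y'.1 * R y'.1) a y'.2 * (R y'.1 *ᵥ Ψ y'.1) y'.2)
          fun s' => (hBRc s').mul (hbU s')).symm
    _ = ∫ y', (B U y'.1 * R y'.1) a y'.2 * φ y' ∂((sliceHaar S).prod Measure.count) := by
        refine integral_congr_ae ?_
        filter_upwards [hae] with y' hy'
        rw [hy']
    _ = (lam : ℂ) * Ψ U a := by
        rw [hΨ, ← mul_assoc, mul_inv_cancel₀ hlamC, one_mul]

end StubEigenvectorToEigenwave

open StubEigenvectorToEigenwave StubEigenRayleigh in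
/-- **Registered stub `stub_eigenvector_to_eigenwave` of step E3: an eigenvector of the scalarised QCD
transfer operator with non-zero eigenvalue is `R Ψ` for a continuous gauge-invariant eigenwave `Ψ` of the
`R`-free transfer map.**  For the `L²(Haar ⊗ count)` integral operator `A` of
`k((U,s),(U',s')) = (R(U) B(U,U') R(U'))_{s s'}`, `B(U,U') = ∫ K_β(U,U'^g) Γ(G_g) dg`, `R = √T̂_F` pointwise,
`A φ = λ φ` with `λ ≠ 0` yields the continuous gauge-invariant `Ψ(U) = λ⁻¹ ∫ B(U,U') R(U') φ(U',·)` with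
`R Ψ = φ` a.e. and `∫ B(U,U') T̂_F(U') Ψ(U') dU' = λ Ψ(U)` for every `U`
(`StubEigenvectorToEigenwave.main_of_bondKernel`). [cite: Luscher1977, pp. 283–292]
[cite: ReedSimonIV1978, Thm XIII.1] -/
theorem stub_eigenvector_to_eigenwave : ∀ (Nf S : ℕ) [NeZero S] (β : ℝ) (mq : Fin Nf → ℝ), (∀ f, -1 < mq f) →
    ∀ R : GaugeConfig 3 S (Matrix.specialUnitaryGroup (Fin 3) ℂ) → Matrix (Finset (SliceFermiIdx Nf S)) (Finset (SliceFermiIdx Nf S)) ℂ,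
    Continuous R → (∀ U, (R U)ᴴ = R U ∧ R U * R U = fermionSliceOp U mq) →
    ∀ k : GaugeConfig 3 S (Matrix.specialUnitaryGroup (Fin 3) ℂ) × Finset (SliceFermiIdx Nf S) → GaugeConfig 3 S (Matrix.specialUnitaryGroup (Fin 3) ℂ) × Finset (SliceFermiIdx Nf S) → ℂ,
    (∀ y y', k y y' = (R y.1 * (Matrix.of fun a c => ∫ g : TorusSite 3 S → (Matrix.specialUnitaryGroup (Fin 3) ℂ),
            (gaugeSliceKernel β y.1 (gaugeTransform g y'.1) : ℂ) * @fockGaugeAct Nf S _ g a c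
              ∂(Measure.pi fun _ => haarProbability (Matrix.specialUnitaryGroup (Fin 3) ℂ))) * R y'.1) y.2 y'.2) →
    ∀ A : Lp ℂ 2 ((sliceHaar S).prod (Measure.count : Measure (Finset (SliceFermiIdx Nf S)))) →L[ℂ]
        Lp ℂ 2 ((sliceHaar S).prod (Measure.count : Measure (Finset (SliceFermiIdx Nf S)))),
      (∀ φ : Lp ℂ 2 ((sliceHaar S).prod (Measure.count : Measure (Finset (SliceFermiIdx Nf S)))),
        (A φ : GaugeConfig 3 S (Matrix.specialUnitaryGroup (Fin 3) ℂ) × Finset (SliceFermiIdx Nf S) → ℂ)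
          =ᵐ[(sliceHaar S).prod (Measure.count : Measure (Finset (SliceFermiIdx Nf S)))]
          fun y => ∫ y', k y y' * φ y' ∂((sliceHaar S).prod (Measure.count : Measure (Finset (SliceFermiIdx Nf S))))) →
    ∀ (φ : Lp ℂ 2 ((sliceHaar S).prod (Measure.count : Measure (Finset (SliceFermiIdx Nf S))))) (lam : ℝ),
      lam ≠ 0 → A φ = (lam : ℂ) • φ →
      ∃ Ψ : SliceWave Nf S, Continuous Ψ ∧ IsGaugeInvariantWave Ψ ∧
        ((fun y : GaugeConfig 3 S (Matrix.specialUnitaryGroup (Fin 3) ℂ) × Finset (SliceFermiIdx Nf S) => (R y.1 *ᵥ Ψ y.1) y.2)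
          =ᵐ[(sliceHaar S).prod (Measure.count : Measure (Finset (SliceFermiIdx Nf S)))]
          (φ : GaugeConfig 3 S (Matrix.specialUnitaryGroup (Fin 3) ℂ) × Finset (SliceFermiIdx Nf S) → ℂ)) ∧
        ∀ (U : GaugeConfig 3 S (Matrix.specialUnitaryGroup (Fin 3) ℂ)) (a : Finset (SliceFermiIdx Nf S)),
          (∫ U', (((Matrix.of fun a' c => ∫ g : TorusSite 3 S → (Matrix.specialUnitaryGroup (Fin 3) ℂ),
            (gaugeSliceKernel β U (gaugeTransform g U') : ℂ) * @fockGaugeAct Nf S _ g a' c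
              ∂(Measure.pi fun _ => haarProbability (Matrix.specialUnitaryGroup (Fin 3) ℂ))) * fermionSliceOp U' mq) *ᵥ Ψ U') a ∂(sliceHaar S)) = (lam : ℂ) * Ψ U a := by
  intro Nf S _ β mq _ R hRc hR k hk A hA φ lam hlam hAφ
  exact main_of_bondKernel
    (B := fun U U' => Matrix.of fun a c => ∫ g : TorusSite 3 S → (Matrix.specialUnitaryGroup (Fin 3) ℂ),
      (gaugeSliceKernel β U (gaugeTransform g U') : ℂ) * @fockGaugeAct Nf S _ g a c
        ∂(Measure.pi fun _ => haarProbability (Matrix.specialUnitaryGroup (Fin 3) ℂ)))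
    hRc (fun a c => by simpa only [Matrix.of_apply] using stub_bondKernel_continuous Nf S β a c) mq
    (fun h U U' => bondKernel_gaugeTransform_left β h U U') (fun U => (hR U).2) k hk A hA φ lam hlam hAφ

end Summit.QuantumFields.QCD.Cruxes.StableActionBridge.TwistedTraceTransfer

end
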